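import Mathlib
import HarnessLib

/-!
# Typed remarks on line `ember_census` (E2 `TerminalEmber`) as kernel facts — refuter lane ns-afl-r1

Supports crux stmt-NavierStokesRegularity-24077 (`QuarterLogPincer.TypeIQuantSubcubicExp`) via the NEW LINE
`Cruxes/TypeIQuantSubcubicExp/Lines/ember_census.lean` v1.1 (ns-idea-7 g12; sha12 374488482d99) and ns-afl-r1's
typed audit v7 (evidence `AUDIT-newlines-24077-v7.md` on the item).  The two event predicates `Hot`, `Terminal`
are restated VERBATIM (crux workfiles are not importable; identity with a future port = `Iff.rfl`).

Facts (all elementary; NO Theses decl is asserted, nothing about E1/E2/G1♯/R0/the crux is proved or refuted):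
* `not_hot_zero` — the rest state has no hot event (`ε ≥ 0`): E1/E2 are vacuous there (audit v7 §4.1).
* `terminal_horizon` — every event AT the horizon `t₁ = t` is terminal: E2 contains the final-slice sub-claim
  E2⁰ (audit v7 §4.4, the prover's suggested first landing).
* `not_hot_of_room_of_supNonincreasing` — **the Λ-room vacuity** (audit v7 §4.3): under the frame's Type-I
  rate at time `0` (`‖u 0 x‖ ≤ M·T'^{-1/2}`), room `Λ(T'−t) ≤ t` and `(M/ε)² ≤ Λ + 1`, a flow whose pointwise
  size at time `t` is dominated by its size at time `0` (`∀ y ∃ x, ‖u t y‖ ≤ ‖u 0 x‖` — heat-like / small data)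
  has NO ε-hot event at time `t`.  Since E2 quantifies `∃ Λ` AFTER `∀ ε`, E2 AS TYPED is vacuously true on every
  such class once `Λ ≥ (M/ε)² − 1`; the card's cheapest falsifier (linear families) cannot bite it until `Λ` is
  pinned.  Recorded so that instrument rows are not run on small-data flows. [folklore]
-/

-- the summit and its single sub-problem share the name (CONVENTIONS §1), as in every Theorems file
set_option linter.dupNamespace false

namespace Summit.NavierStokesRegularity.NavierStokesRegularity.Theorems.TypeIQuantSubcubicExp.Negative.EmberCensus

noncomputable section

open Real

/-- **HOT EVENT** (VERBATIM from `Lines/ember_census.lean` v1.1): `T' − t ≤ t ∧ ε < √(T'−t)·‖u t y‖`. -/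
def Hot (ε T' : ℝ) (u : ℝ → (EuclideanSpace ℝ (Fin 3)) → (EuclideanSpace ℝ (Fin 3)))
    (y : (EuclideanSpace ℝ (Fin 3))) (t : ℝ) : Prop :=
  T' - t ≤ t ∧ ε < Real.sqrt (T' - t) * ‖u t y‖

/-- **TERMINAL** hot event (VERBATIM from `Lines/ember_census.lean` v1.1): no hot successor of clock at most
half, within `4K√(T'−t)`, up to the horizon `t₁`. -/
def Terminal (K ε T' t₁ : ℝ) (u : ℝ → (EuclideanSpace ℝ (Fin 3)) → (EuclideanSpace ℝ (Fin 3)))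
    (y : (EuclideanSpace ℝ (Fin 3))) (t : ℝ) : Prop :=
  ∀ (y' : (EuclideanSpace ℝ (Fin 3))) (t' : ℝ), t < t' → t' ≤ t₁ → 4 * (T' - t') ≤ T' - t →
    ‖y' - y‖ ≤ 4 * K * Real.sqrt (T' - t) → ¬ Hot ε T' u y' t'

/-- The rest state has no hot event (for `ε ≥ 0`): E1 and E2 hold vacuously at `u ≡ 0`. -/
theorem not_hot_zero {ε : ℝ} (hε : 0 ≤ ε) (T' : ℝ) (y : (EuclideanSpace ℝ (Fin 3))) (t : ℝ) :
    ¬ Hot ε T' (0 : ℝ → (EuclideanSpace ℝ (Fin 3)) → (EuclideanSpace ℝ (Fin 3))) y t := by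
  rintro ⟨-, h⟩
  simp only [Pi.zero_apply, norm_zero, mul_zero] at h
  exact absurd h (not_lt.2 hε)

/-- Every event at the horizon (`t₁ = t`) is terminal: there is no `t'` with `t < t' ≤ t`.  Hence E2
`TerminalEmber` contains the final-slice statement «ε-hot at `t₁` ⇒ ember around it» (audit v7 §4.4). -/
theorem terminal_horizon (K ε T' : ℝ) (u : ℝ → (EuclideanSpace ℝ (Fin 3)) → (EuclideanSpace ℝ (Fin 3)))
    (y : (EuclideanSpace ℝ (Fin 3))) (t : ℝ) : Terminal K ε T' t u y t := by
  intro y' t' htt' ht'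
  exact absurd (lt_of_lt_of_le htt' ht') (lt_irrefl t)

/-- **Λ-room vacuity.**  Under the Type-I rate at time `0`, room `Λ(T'−t) ≤ t` (`Λ ≥ 0`) and
`(M/ε)² ≤ Λ + 1`, a flow
whose pointwise size at time `t` is dominated by its size at time `0` has no ε-hot event at time `t`:
`ε < √(T'−t)‖u t y‖ ≤ √(T'−t)·M/√T' ≤ M/√(Λ+1) ≤ ε`. -/
theorem not_hot_of_room_of_supNonincreasing {ε M Λ T' t : ℝ}
    {u : ℝ → (EuclideanSpace ℝ (Fin 3)) → (EuclideanSpace ℝ (Fin 3))} {y : (EuclideanSpace ℝ (Fin 3))}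
    (hε : 0 < ε) (hΛ0 : 0 ≤ Λ) (hΛ : (M / ε) ^ 2 ≤ Λ + 1)
    (hrate0 : ∀ x : (EuclideanSpace ℝ (Fin 3)), ‖u 0 x‖ ≤ M * T' ^ (-(1 / 2 : ℝ)))
    (hroom : Λ * (T' - t) ≤ t)
    (hmono : ∃ x : (EuclideanSpace ℝ (Fin 3)), ‖u t y‖ ≤ ‖u 0 x‖) :
    ¬ Hot ε T' u y t := by
  rintro ⟨-, hhot⟩
  obtain ⟨x, hx⟩ := hmono
  have hux : ‖u t y‖ ≤ M * T' ^ (-(1 / 2 : ℝ)) := hx.trans (hrate0 x)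
  -- the clock at the hot time is positive (else `√(T'−t) = 0` and `ε < 0`)
  have hσpos : 0 < T' - t := by
    by_contra hle
    have h0 : Real.sqrt (T' - t) = 0 := Real.sqrt_eq_zero'.2 (not_lt.1 hle)
    rw [h0, zero_mul] at hhot
    exact absurd hhot (not_lt.2 hε.le)
  have hΛσ : 0 ≤ Λ * (T' - t) := mul_nonneg hΛ0 hσpos.le
  have hT'ge : (Λ + 1) * (T' - t) ≤ T' := by linarith [hroom]
  have hT'pos : 0 < T' := by linarith
  have hΛ1 : 0 < Λ + 1 := by linarith
  -- `M ≥ 0` (the rate bounds a norm) and `M * T'^{-1/2} = M / √T'`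
  have hM0 : 0 ≤ M := by
    have h := (norm_nonneg _).trans (hrate0 x)
    have hTp : 0 < T' ^ (-(1 / 2 : ℝ)) := Real.rpow_pos_of_pos hT'pos _
    nlinarith
  have hrpow : T' ^ (-(1 / 2 : ℝ)) = (Real.sqrt T')⁻¹ := by
    rw [Real.rpow_neg hT'pos.le, Real.sqrt_eq_rpow]
  have hsqT : 0 < Real.sqrt T' := Real.sqrt_pos.2 hT'pos
  -- ε < √(T'−t) · M / √T'
  have h1 : ε < Real.sqrt (T' - t) * (M * (Real.sqrt T')⁻¹) := by
    rw [← hrpow]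
    exact hhot.trans_le (mul_le_mul_of_nonneg_left hux (Real.sqrt_nonneg _))
  -- √(T'−t)/√T' ≤ 1/√(Λ+1)
  have hratio : Real.sqrt (T' - t) * (Real.sqrt T')⁻¹ ≤ (Real.sqrt (Λ + 1))⁻¹ := by
    rw [← div_eq_mul_inv, ← Real.sqrt_div hσpos.le, ← Real.sqrt_inv]
    apply Real.sqrt_le_sqrt
    rw [div_le_iff₀ hT'pos, ← one_div, one_div_mul_eq_div, le_div_iff₀ hΛ1]
    linarith
  -- M/√(Λ+1) ≤ ε
  have hMε : M * (Real.sqrt (Λ + 1))⁻¹ ≤ ε := by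
    have hsq : M / ε ≤ Real.sqrt (Λ + 1) := by
      rw [← Real.sqrt_sq (div_nonneg hM0 hε.le)]
      exact Real.sqrt_le_sqrt hΛ
    have hsΛ : 0 < Real.sqrt (Λ + 1) := Real.sqrt_pos.2 hΛ1
    rw [div_le_iff₀ hε] at hsq
    rw [mul_inv_le_iff₀ hsΛ]
    linarith [mul_comm ε (Real.sqrt (Λ + 1))]
  have : ε < ε :=
    calc ε < Real.sqrt (T' - t) * (M * (Real.sqrt T')⁻¹) := h1
      _ = M * (Real.sqrt (T' - t) * (Real.sqrt T')⁻¹) := by ring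
      _ ≤ M * (Real.sqrt (Λ + 1))⁻¹ := mul_le_mul_of_nonneg_left hratio hM0
      _ ≤ ε := hMε
  exact lt_irrefl _ this

end

end Summit.NavierStokesRegularity.NavierStokesRegularity.Theorems.TypeIQuantSubcubicExp.Negative.EmberCensus
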